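import Summits.ResolutionOfSingularities.ResolutionOfSingularities.Theorems.WeightedInvariantELadderOneBase
import HarnessLib

/-!
# e-ladder, rung `e = 1`: the dimension datum (I0) of a stage, and the START stage with (I0)

Route `ResolutionOfSingularities/WeightedInvariant`, crux `Theses.WeightedInvariant.HypersurfaceCentreConstruction`
(stmt-ResolutionOfSingularities-19897), door line `e-ladder`, rung `e = 1` (E1 skeleton of res-L1-w43-stub-10).
res-type-017's RESHAPE REQUEST (cell res-hironaka STATUS 2026-08-27T07:52:03Z, design `D/res-type-017/E1-InvPrime.design.lean`)
adds to the rung invariant the DIMENSION DATUM (I0) `topologicalKrullDim S.X = S.j + 1`. This def-free helper file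
supplies the two facts the adapter of `stub_e1_base` (p508242) to that datum needs:

* `Stage.topologicalKrullDim_X_eq_subscheme_toPair` — the hypersurface `S.X` of a stage and the subscheme
  `V(ker i)` of its underlying pair have the same topological Krull dimension (both are homeomorphic to the closed
  subset `supp (ker i) = range i` of the ambient); this is also the bookkeeping identity a successor stage needs to
  read its dimension off its pair;
* `stub_e1_base_dim` — `stub_e1_base` with the conjunct (I0) added: for a hypersurface pair whose hypersurface is a
  curve, the start stage has `dim X = 1 = j + 1`.

Helper lemmas are def-free; `--supports stmt-ResolutionOfSingularities-19897`. Nothing here is a claim about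
Hironaka's problem or about resolution in positive characteristic; the rung is OURS.
-/

noncomputable section

set_option linter.dupNamespace false -- mandated namespace of this single-conjunct summit

open CategoryTheory AlgebraicGeometry TopologicalSpace Topology
open Literature.AlgebraicGeometry.Resolution
open Summit.ResolutionOfSingularities.ResolutionOfSingularities.Theorems

namespace Summit.ResolutionOfSingularities.ResolutionOfSingularities.Theorems.ELadderOne

/-! ## §1 Topological Krull dimension along a closed immersion -/

section ClosedImmersion

variable {X Y : Scheme.{0}} (i : X ⟶ Y) [IsClosedImmersion i]

/-- The source of a closed immersion has the topological Krull dimension of the support of its kernel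
(a closed immersion is a homeomorphism onto its range, and the range is the support of the kernel). [folklore] -/
theorem topologicalKrullDim_eq_support_ker :
    topologicalKrullDim X = topologicalKrullDim (i.ker.support : Set Y) := by
  have hr : Set.range i.base = (i.ker.support : Set Y) := by
    rw [Scheme.Hom.support_ker, i.isClosedEmbedding.isClosed_range.closure_eq]
  let e : X ≃ₜ (i.ker.support : Set Y) :=
    i.isClosedEmbedding.isEmbedding.toHomeomorph.trans (Homeomorph.setCongr hr)
  exact IsHomeomorph.topologicalKrullDim_eq e e.isHomeomorph

/-- The subscheme `V(ker i)` of the kernel of a closed immersion `i : X ⟶ Y` has the topological Krull dimension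
of `X`. [folklore] -/
theorem topologicalKrullDim_subscheme_ker_eq :
    topologicalKrullDim i.ker.subscheme = topologicalKrullDim X := by
  rw [topologicalKrullDim_eq_support_ker i]
  let e : i.ker.subscheme ≃ₜ (i.ker.support : Set Y) :=
    i.ker.subschemeι.isClosedEmbedding.isEmbedding.toHomeomorph.trans
      (Homeomorph.setCongr (Scheme.IdealSheafData.range_subschemeι i.ker))
  exact IsHomeomorph.topologicalKrullDim_eq e e.isHomeomorph

end ClosedImmersion

/-! ## §2 The dimension datum of a stage -/

namespace Stage

variable {k : Type} [Field k]

/-- **The hypersurface of a stage and the subscheme of its underlying pair have the same topological Krull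
dimension** (`S.toPair.X = ker S.i`, and both `S.X` and `V(ker S.i)` are homeomorphic to `supp (ker S.i)`).
[folklore] -/
theorem topologicalKrullDim_X_eq_subscheme_toPair (S : Stage k) :
    topologicalKrullDim S.X = topologicalKrullDim S.toPair.X.subscheme :=
  (topologicalKrullDim_subscheme_ker_eq S.i).symm

end Stage

/-! ## §3 The start stage with its dimension datum -/

variable {k : Type} [Field k]

/-- **`stub_e1_base` with the dimension datum (I0).** A hypersurface pair whose hypersurface is a CURVE is a
stage of rank `j = 0` satisfying `Inv` AND `dim X = j + 1 (= 1)`: the stage of `stub_e1_base` presents `P`, so its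
hypersurface has the dimension of `V(P.X)`. [folklore] -/
theorem stub_e1_base_dim (P : HypersurfacePair k)
    (hP : topologicalKrullDim P.X.subscheme = ((1 : ℕ) : WithBot ℕ∞)) :
    ∃ S : Stage k, S.Inv ∧ topologicalKrullDim S.X = ((S.j + 1 : ℕ) : WithBot ℕ∞) ∧ S.j = 0 ∧
      S.toPair = P := by
  obtain ⟨S, hInv, hj, hSP⟩ := stub_e1_base P hP
  refine ⟨S, hInv, ?_, hj, hSP⟩
  rw [S.topologicalKrullDim_X_eq_subscheme_toPair, hSP, hP, hj]

end Summit.ResolutionOfSingularities.ResolutionOfSingularities.Theorems.ELadderOne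

end
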